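import Summits.CriticalPhenomena.PercolationContinuityZ3.Theorems.Transplant.SqShadowVRoutingR
import Summits.CriticalPhenomena.PercolationContinuityZ3.Theorems.Transplant.SqShadowVRouteDataX
import HarnessLib

/-!
# SQUARE SHADOWS — THE ROUTING FROM `ShapedLinkageX R` (exit form): located surgeries, the Gluing Lemma and `θ_v(p_c) = 0` for THIN instances

builds on p205010 (kernel theorem, internal audit signed; external expert review pending) — NOT used in this file.  Lane `prim-bschramm`, seat `prim-bschramm-p2` (gen 42; class C1b;
memo `HOME/bschramm/P2-LATTICES.md` §148); helper file (`--supports stmt-CriticalPhenomena-4575 --as helper`).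
«SqShadowVRoutingR» with the instance obligation weakened to `ShapedLinkageX R` («SqShadowVRouteDataX»: the swap pair is owed only for exit vertices `w'` having a neighbour
outside the cleared set `W`, inside the cleared window, off the columns of `z, E₁, E₂`).  The generic side certifies that exit property (DST: "choose `w'` on the boundary of
`B̄_R(z)` such that `π` … lies outside"): `w'` is the last vertex in `W` of the `(P2)`-witness `π`, whose next vertex is the exit neighbour — unless `π` ends inside `W` over
`S'_n`; then, provided `S'_n ⊄ sqBall z R` (all other `z` are within `R` of the centre of `S'_n`: at most `(2R+1)²` points, added to `N₀`), the lift of the box `S'_n` is connected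
(hypothesis `hconn`, boxes of radius `≥ 1`) and not inside `W`, so it has an edge from `W` to its outside, over `S'_n`, hence off the columns of `γ_min` (`γ_min` over `S'_n`
would give `C`).  Two mild hypotheses on the instance enter: `hsurj` (every column is inhabited) and `hconn`.
* §1 `inWinD_of_mem_small`, **`exists_sigma_exit`**, **`exists_vsurgery_of_shapedLinkageX`**;
* §2 **`sqLocatedSurgeriesR_of_shapedLinkageX`**, **`sqGluing_of_shapedLinkageX`**, **`theta_criticalProb_eq_zero_of_shapedLinkageX`**.
[cite: DuminilCopinSidoraviciusTassion2016, §2.3 (proof of Fact 2, pp. 6–7: "fix R", u', v', w' on the boundary of B̄_R(z), the path π outside)] [cite: NewmanTassionWu2017, §3.2]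
-/

noncomputable section

namespace Summit.CriticalPhenomena.PercolationContinuityZ3.Theorems.Transplant

open MeasureTheory Literature.Probability.Percolation Literature.Probability.LatticeModels SimpleGraph Filter
open scoped Classical Topology

namespace SqShadow

variable {V : Type} {G : SimpleGraph V} {Ψ : SqShadow G} [Countable V]

/-! ## §1 The exit property of the witness, and the surgery at a good point of `U(ω)` -/

omit [Countable V] in
/-- A point of `B'_n` lies in the cleared window `{ξ ≤ ξ(z) + t_D} ∩ {η ≤ η(z) + s_D}` of the block of any `z`. [folklore] -/
theorem inWinD_of_mem_small {Γ : GlueData} (z : Site 2) {w : Site 2} (hw : w ∈ Ψ.small Γ) : SqShadow.InWin z (Ψ.tD Γ z) (Ψ.sD Γ z) w := by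
  rw [mem_small_iff] at hw
  refine ⟨?_, ?_⟩
  · unfold tD; omega
  · unfold sD
    have : Ψ.period * Γ.s - 2 * Γ.m ≤ max (Ψ.period * Γ.s - 2 * Γ.m) 0 := le_max_left _ _
    omega

/-- **THE EXIT PROPERTY OF THE `(P2)`-WITNESS** (DST: `w'` on the boundary of `B̄_R(z)` with `π` outside).  For `ω ∈ 𝒳`, `z ∈ U(ω)` with `S'_n ⊄ sqBall z R`, and a vertex
set `W` between the lift of `sqBall z 1 ∩ B'_n` and the lift of `sqBall z R`: a vertex `w ∈ W`, an `ω`-open path `σ` from `w` to `\overline{S'_n}` inside `\overline{B'_n}` off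
the columns of `γ_min` with `σ.tail` outside `W`, AND a neighbour `x ∉ W` of `w` over `B'_n` off the columns of `γ_min` (the second vertex of `σ`; or, when `π` ends inside `W`,
an edge of the connected lift of the box `S'_n` leaving `W`).  Needs: every column inhabited (`hsurj`), lifts of boxes of radius `≥ 1` connected (`hconn`).
[cite: DuminilCopinSidoraviciusTassion2016, §2.3 (Definition of U(ω), (P2); proof of Fact 2, the path π and w')] -/
theorem exists_sigma_exit (hsurj : Function.Surjective Ψ.sh)
    (hconn : ∀ (c : Site 2) (u : ℕ), 1 ≤ u → ∀ a ∈ Ψ.lift (sqBall c u), ∀ b ∈ Ψ.lift (sqBall c u), ∃ p : G.Walk a b, ∀ v ∈ p.support, v ∈ Ψ.lift (sqBall c u))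
    {Γ : GlueData} (hΓ : Ψ.InRange Γ) {ω : BondConfig V} (hω : ω ⊆ G.edgeSet) (hX : ω ∈ Ψ.evX Γ) {z : Site 2} (hz : z ∈ Ψ.U Γ ω) {R : ℕ}
    (hsrc : ¬ Ψ.src' Γ ⊆ sqBall z R) {W : Set V} (hW : ∀ x : V, Ψ.sh x ∈ sqBall z 1 → Ψ.sh x ∈ Ψ.small Γ → x ∈ W) (hWR : W ⊆ Ψ.lift (sqBall z R)) :
    ∃ (w : V) (σ : List V), σ.head? = some w ∧ w ∈ W ∧ σ.IsChain (fun a b => s(a, b) ∈ ω ∧ a ≠ b) ∧ (∀ x ∈ σ, Ψ.sh x ∈ Ψ.small Γ) ∧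
      (∀ x ∈ σ, Ψ.sh x ∉ Ψ.γcols Γ ω) ∧ (∀ x ∈ σ.tail, x ∉ W) ∧ (∀ h : σ ≠ [], σ.getLast h ∈ Ψ.lift (Ψ.src' Γ)) ∧
      ∃ x : V, G.Adj w x ∧ x ∉ W ∧ Ψ.sh x ∈ Ψ.small Γ ∧ Ψ.sh x ∉ Ψ.γcols Γ ω := by
  have hA : ω ∈ Ψ.evA Γ := hX.1.1.1
  have hnotC : ω ∉ Ψ.evC Γ := hX.2
  -- no vertex over `S'_n` is on `γ_min` (else `C`), so the columns of `S'_n` are off `γcols`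
  have hsrc'γ : ∀ x : V, Ψ.sh x ∈ Ψ.src' Γ → Ψ.sh x ∉ Ψ.γcols Γ ω := by
    rintro x hx ⟨g, hg, hgx⟩
    exact hnotC (Ψ.evC_of_mem_γmin_of_src' Γ hA hg (by rw [mem_lift, hgx]; exact hx))
  have hsrc'small : Ψ.src' Γ ⊆ Ψ.small Γ := by
    obtain ⟨-, -, hu₁, -⟩ := hΓ
    exact sqBall_mono _ (by omega)
  obtain ⟨w, σ, hσhead, hwW, hσchain, hσsmall, hσγ, hσW, hσsrc'⟩ := Ψ.exists_sigma_of_mem_UV Γ hz (W := W) hW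
  have hσne : σ ≠ [] := by rintro rfl; simp at hσhead
  obtain ⟨w₀, rest, hσeq₀⟩ := List.exists_cons_of_ne_nil hσne
  have hw₀ : w₀ = w := by rw [hσeq₀] at hσhead; simpa using hσhead
  have hσeq : σ = w :: rest := by rw [← hw₀]; exact hσeq₀
  clear hσeq₀ hw₀
  rcases rest with _ | ⟨x, rest'⟩
  · -- `π` ends inside `W`: `w ∈ \overline{S'_n}`; exit through the connected lift of the box `S'_n`
    subst hσeq
    have hwsrc' : Ψ.sh w ∈ Ψ.src' Γ := by have := hσsrc' (List.cons_ne_nil _ _); rwa [List.getLast_singleton, mem_lift] at this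
    -- a column of `S'_n` outside `sqBall z R`, inhabited
    obtain ⟨q, hq, hqR⟩ := Set.not_subset.1 hsrc
    obtain ⟨vq, hvq⟩ := hsurj q
    have hvqW : vq ∉ W := fun h => hqR (by have := hWR h; rw [mem_lift, hvq] at this; exact this)
    -- the radius of `S'_n` is positive (else `S'_n = {c'} ∋ sh w ∈ sqBall z R`)
    have hu₁ : 1 ≤ Γ.u₁ := by
      by_contra h0
      have h0' : Γ.u₁ = 0 := by omega
      apply hqR
      have hwq : Ψ.sh w = q := by
        simp only [src', h0', mem_sqBall_iff_linear, Nat.cast_zero] at hwsrc' hq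
        ext j; fin_cases j
        · change Ψ.sh w 0 = q 0; omega
        · change Ψ.sh w 1 = q 1; omega
      rw [← hwq]; have := hWR hwW; rwa [mem_lift] at this
    obtain ⟨p, hp⟩ := hconn _ _ hu₁ w (by rw [mem_lift]; exact hwsrc') vq (by rw [mem_lift, hvq]; exact hq)
    obtain ⟨d, hd, hdW, hdW'⟩ := p.exists_boundary_dart W hwW hvqW
    have hd1 : d.toProd.1 ∈ Ψ.lift (Ψ.src' Γ) := hp _ (p.dart_fst_mem_support_of_mem_darts hd)
    have hd2 : d.toProd.2 ∈ Ψ.lift (Ψ.src' Γ) := hp _ (p.dart_snd_mem_support_of_mem_darts hd)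
    rw [mem_lift] at hd1 hd2
    refine ⟨d.toProd.1, [d.toProd.1], rfl, hdW, List.isChain_singleton _, ?_, ?_, ?_, ?_, d.toProd.2, d.adj, hdW', hsrc'small hd2, hsrc'γ _ hd2⟩
    · intro y hy; rw [List.mem_singleton] at hy; subst hy; exact hsrc'small hd1
    · intro y hy; rw [List.mem_singleton] at hy; subst hy; exact hsrc'γ _ hd1
    · intro y hy; simp at hy
    · intro h; rw [List.getLast_singleton, mem_lift]; exact hd1
  · -- `σ = w :: x :: rest'`: the exit neighbour is `x`
    have hwx : s(w, x) ∈ ω ∧ w ≠ x := by rw [hσeq] at hσchain; exact (List.isChain_cons_cons.1 hσchain).1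
    refine ⟨w, σ, hσhead, hwW, hσchain, hσsmall, hσγ, hσW, hσsrc', x, ?_, ?_, ?_, ?_⟩
    · exact (SimpleGraph.mem_edgeSet G).1 (hω hwx.1)
    · exact hσW x (by rw [hσeq]; simp)
    · exact hσsmall x (by rw [hσeq]; simp)
    · exact hσγ x (by rw [hσeq]; simp)


/-- **THE VERTEX-SET SURGERY EXISTS AT EVERY GOOD POINT OF `U(ω)`, given `ShapedLinkage`** at surgery radius `R` from `ShapedLinkageX R` (DST 2016, §2.3, proof of Fact 2: "fix `R`"; the construction of `ω^{(z)}`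
as the data `SqShadow.VSurgery` with cleared vertices `W ⊆ \overline{sqBall z R}`).  `W` is the instance's cleared set for the block pair `(RP(z), D(z))`
(between the lifts of `sqBall z 1 ∩ D(z)` and of `D(z)`); `E₁, E₂` are the first and last visits of `γ_min` to `W` (two distinct visits exist: the vertex over `z`
and its successor lie in `W`; the start over `S_{3n}` and the end are outside); the terminal data `Terminals` is certified from `γ_min` (its neighbours
`o₁, a₁, a₂, o₂` of `E₁, E₂`, inside the window, distinct by self-avoidance, `a₁ = a₂` only over `z`) and from the `(P2)`-witness (`w'` off the columns of
`γ_min`); the keyed routing comes from the swap pair; the key condition over `S_{3n}` is vacuous. [cite: DuminilCopinSidoraviciusTassion2016, §2.3, proof of Fact 2 (pp. 6–7)] -/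
theorem exists_vsurgery_of_shapedLinkageX {R : ℕ} (hL : Ψ.ShapedLinkageX R) (hR : 1 ≤ R) (hsurj : Function.Surjective Ψ.sh)
    (hconn : ∀ (c : Site 2) (u : ℕ), 1 ≤ u → ∀ a ∈ Ψ.lift (sqBall c u), ∀ b ∈ Ψ.lift (sqBall c u), ∃ p : G.Walk a b, ∀ v ∈ p.support, v ∈ Ψ.lift (sqBall c u))
    {Γ : GlueData} (hΓ : Ψ.InRange Γ) (hm : 4 * R + 1 ≤ Γ.m)
    {ω : BondConfig V} (hω : ω ⊆ G.edgeSet) (hX : ω ∈ Ψ.evX Γ) {z : Site 2} (hz : z ∈ Ψ.U Γ ω) (hX₁ : z ∉ Ψ.X₁R R Γ) (hX₂ : z ∉ Ψ.X₂R R Γ)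
    (hzb : z ∉ Ψ.zBadR R Γ) (hfar : ∀ v ∈ (Ψ.γmin Γ ω).getLast?, z ∉ sqBall (Ψ.sh v) R) (hsrc : ¬ Ψ.src' Γ ⊆ sqBall z R) :
    ∃ sg : Ψ.VSurgery Γ ω, sg.W ⊆ Ψ.lift (sqBall z R) := by
  have hA : ω ∈ Ψ.evA Γ := hX.1.1.1
  obtain ⟨hγO, -⟩ := Ψ.γmin_spec Γ hA
  have hzU := hz
  obtain ⟨hzs, ⟨g, hgγ, hgz⟩, -⟩ := hz
  have hzbig : z ∈ Ψ.big Γ := by rw [← hgz]; exact hγO.subset g hgγ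
  have hadj : ∀ {a b : V}, s(a, b) ∈ ω → G.Adj a b := fun h => (SimpleGraph.mem_edgeSet G).1 (hω h)
  -- the instance's cleared set for the block pair `(RP(z), D(z))`
  obtain ⟨htRD, hsRD⟩ := tRR_le_tD (Ψ := Ψ) R Γ z
  obtain ⟨W, hWblk, hWin, hWlink⟩ := Ψ.exists_W_of_shapedLinkageX hL z htRD hsRD (le_tRR_or_sR hX₂)
  have hWD : ∀ x ∈ W, Ψ.sh x ∈ Ψ.DblkR R Γ z := hWblk
  have hW3 : W ⊆ Ψ.lift (sqBall z R) := fun x hx => by rw [mem_lift]; exact Ψ.DblkR_subset_sqBall R Γ z (hWD x hx)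
  have hWwin : W ⊆ Ψ.lift (Ψ.big Γ ∪ Ψ.small Γ) := fun x hx => by
    rw [mem_lift]; exact DblkR_subset_window hΓ hm hzbig hzs hX₁ (hWD x hx)
  have hWbig : ∀ x : V, Ψ.sh x ∈ sqBall z 1 → Ψ.sh x ∈ Ψ.big Γ → x ∈ W := fun x h1 hb =>
    hWin x h1 (Ψ.sqBall_inter_big_subset_DblkR Γ z (sqBall_mono z hR h1) hb)
  have hWsmall : ∀ x : V, Ψ.sh x ∈ sqBall z 1 → Ψ.sh x ∈ Ψ.small Γ → x ∈ W := fun x h1 hs =>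
    hWin x h1 (Ψ.sqBall_inter_small_subset_DblkR Γ z (sqBall_mono z hR h1) hs)
  -- a vertex adjacent to a vertex over `z`, over `big`, lies in `W`
  have hnbW : ∀ {a b : V}, Ψ.sh a = z → G.Adj a b → Ψ.sh b ∈ Ψ.big Γ → b ∈ W := by
    intro a b ha hab hb
    refine hWbig b ?_ hb
    rw [mem_sqBall, Nat.cast_one, ← ha, abs_sub_comm (Ψ.sh b 0), abs_sub_comm (Ψ.sh b 1)]
    exact ⟨Ψ.abs_sh_sub_sh_le_one hab 0, Ψ.abs_sh_sub_sh_le_one hab 1⟩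
  -- `g ∈ W`; the end and the start of `γ` are outside `W`
  have hz1 : z ∈ sqBall z 1 := centre_mem_sqBall z 1
  have hgW : g ∈ W := hWbig g (hgz.symm ▸ hz1) (hgz.symm ▸ hzbig)
  have hlastW : (Ψ.γmin Γ ω).getLast hγO.ne_nil ∉ W := by
    intro h
    have := hfar ((Ψ.γmin Γ ω).getLast hγO.ne_nil) (by rw [List.getLast?_eq_some_getLast hγO.ne_nil]; rfl)
    have h3 := hW3 h
    rw [mem_lift] at h3
    exact this (mem_sqBall_comm.1 h3)
  have hheadW : ∀ h : Ψ.γmin Γ ω ≠ [], (Ψ.γmin Γ ω).head h ∉ W := by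
    intro h hW
    exact DblkR_disjoint_src hΓ hm hzs (hWD _ hW) (hγO.head_mem h)
  have hzZ : z ∉ Ψ.zSeg Γ := by
    intro hzZ
    have hg := Ψ.eq_getLast_of_sh_mem_zSeg Γ hA hgγ (hgz.symm ▸ hzZ)
    exact hlastW (hg ▸ hgW)
  -- two distinct vertices of `γ` in `W`: `g` and its successor
  have htwo : ∃ a ∈ Ψ.γmin Γ ω, ∃ b ∈ Ψ.γmin Γ ω, a ≠ b ∧ a ∈ W ∧ b ∈ W := by
    obtain ⟨l₁, l₂, hsplit⟩ := List.append_of_mem hgγ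
    have hl₂ : l₂ ≠ [] := by
      rintro rfl
      have : (Ψ.γmin Γ ω).getLast hγO.ne_nil = g := by simp only [hsplit, List.getLast_append_of_ne_nil _ (List.cons_ne_nil _ _), List.getLast_singleton]
      exact hlastW (this ▸ hgW)
    obtain ⟨u, l₂', rfl⟩ := List.exists_cons_of_ne_nil hl₂
    have hch := hγO.chain
    rw [hsplit, List.isChain_append] at hch
    have hgu : s(g, u) ∈ ω ∧ g ≠ u := (List.isChain_cons_cons.1 hch.2.1).1
    have huγ : u ∈ Ψ.γmin Γ ω := by rw [hsplit]; simp
    exact ⟨g, hgγ, u, huγ, hgu.2, hgW, hnbW hgz (hadj hgu.1) (hγO.subset u huγ)⟩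
  -- the decomposition at the first and last visits
  obtain ⟨p₀, E₁, mid, E₂, s₀, hγeq, hp₀, hs₀, hp₀W, hs₀W, hE₁W, hE₂W⟩ := Ψ.γmin_split_atV Γ hA W hheadW (fun h => hlastW) htwo
  have hnd := hγO.nodup
  rw [hγeq] at hnd
  have hE₁γ : E₁ ∈ Ψ.γmin Γ ω := by rw [hγeq]; simp
  have hE₂γ : E₂ ∈ Ψ.γmin Γ ω := by rw [hγeq]; simp
  have hE₁₂ : E₁ ≠ E₂ := by
    intro h
    rw [List.nodup_append] at hnd
    have := (List.nodup_cons.1 hnd.2.1).1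
    exact this (by rw [h]; simp)
  -- `E₁`, `E₂` are off `Z_n` (they are not the last vertex)
  have hE₁Z : Ψ.sh E₁ ∉ Ψ.zSeg Γ := fun hZ => hlastW (Ψ.eq_getLast_of_sh_mem_zSeg Γ hA hE₁γ hZ ▸ hE₁W)
  have hE₂Z : Ψ.sh E₂ ∉ Ψ.zSeg Γ := fun hZ => hlastW (Ψ.eq_getLast_of_sh_mem_zSeg Γ hA hE₂γ hZ ▸ hE₂W)
  have hE₁big : Ψ.sh E₁ ∈ Ψ.big Γ := hγO.subset E₁ hE₁γ
  have hE₂big : Ψ.sh E₂ ∈ Ψ.big Γ := hγO.subset E₂ hE₂γ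
  have hE₁RP : Ψ.sh E₁ ∈ Ψ.RPblkR R Γ z := mem_RPblkR_of hzbig hzZ hzb (hWD _ hE₁W) hE₁big hE₁Z
  have hE₂RP : Ψ.sh E₂ ∈ Ψ.RPblkR R Γ z := mem_RPblkR_of hzbig hzZ hzb (hWD _ hE₂W) hE₂big hE₂Z
  -- the neighbours of `E₁`, `E₂` along `γ`
  have hch := hγO.chain
  rw [hγeq, List.isChain_append] at hch
  set o₁ := p₀.getLast hp₀ with ho₁
  have ho₁E : s(o₁, E₁) ∈ ω := (hch.2.2 o₁ (by simp [ho₁, List.getLast?_eq_some_getLast hp₀]) E₁ (by simp)).1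
  have ho₁p₀ : o₁ ∈ p₀ := List.getLast_mem hp₀
  have ho₁γ : o₁ ∈ Ψ.γmin Γ ω := by rw [hγeq]; exact List.mem_append_left _ ho₁p₀
  have ho₁W : o₁ ∉ W := hp₀W _ ho₁p₀
  set o₂ := s₀.head hs₀ with ho₂
  have h1 := hch.2.1
  rw [List.isChain_cons] at h1
  have h3 := List.isChain_append.1 (show (mid ++ E₂ :: s₀).IsChain _ from h1.2)
  have h4 := h3.2.1
  rw [List.isChain_cons] at h4
  have hE₂o : s(E₂, o₂) ∈ ω := (h4.1 o₂ (by simp [ho₂, List.head?_eq_some_head hs₀])).1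
  have ho₂s₀ : o₂ ∈ s₀ := List.head_mem hs₀
  have ho₂γ : o₂ ∈ Ψ.γmin Γ ω := by rw [hγeq]; simp [ho₂s₀]
  have ho₂W : o₂ ∉ W := hs₀W _ ho₂s₀
  -- `E₁`, `E₂` are not over `z` (their outer neighbours are outside `W`), so `g ∈ mid` and `mid ≠ []`
  have hE₁z : Ψ.sh E₁ ≠ z := fun h => ho₁W (hnbW h (hadj ho₁E).symm (hγO.subset o₁ ho₁γ))
  have hE₂z : Ψ.sh E₂ ≠ z := fun h => ho₂W (hnbW h (hadj hE₂o) (hγO.subset o₂ ho₂γ))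
  have hgmid : g ∈ mid := by
    have hg := hgγ
    rw [hγeq] at hg
    rcases List.mem_append.1 hg with h | h
    · exact absurd hgW (hp₀W g h)
    rcases List.mem_cons.1 h with h | h
    · exact absurd (h ▸ hgz) hE₁z
    rcases List.mem_append.1 h with h | h
    · exact h
    rcases List.mem_cons.1 h with h | h
    · exact absurd (h ▸ hgz) hE₂z
    · exact absurd hgW (hs₀W g h)
  have hmid : mid ≠ [] := List.ne_nil_of_mem hgmid
  set a₁ := mid.head hmid with ha₁
  set a₂ := mid.getLast hmid with ha₂
  have ha₁mid : a₁ ∈ mid := List.head_mem hmid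
  have ha₂mid : a₂ ∈ mid := List.getLast_mem hmid
  have ha₁γ : a₁ ∈ Ψ.γmin Γ ω := by rw [hγeq]; simp [ha₁mid]
  have ha₂γ : a₂ ∈ Ψ.γmin Γ ω := by rw [hγeq]; simp [ha₂mid]
  have hE₁a : s(E₁, a₁) ∈ ω := (h1.1 a₁ (by rw [ha₁, List.head?_append, List.head?_eq_some_head hmid]; rfl)).1
  have ha₂E : s(a₂, E₂) ∈ ω := (h3.2.2 a₂ (by rw [ha₂, List.getLast?_eq_some_getLast hmid]; rfl) E₂ (by simp)).1
  -- distinctness along the self-avoiding `γ = p₀ ++ E₁ :: (mid ++ E₂ :: s₀)`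
  have hnd' := hnd
  rw [List.nodup_append] at hnd'
  obtain ⟨hp₀nd, hrestnd, hdisj⟩ := hnd'
  have hrest2 := (List.nodup_cons.1 hrestnd).2
  rw [List.nodup_append] at hrest2
  obtain ⟨hmidnd, hE₂s₀nd, hdisj2⟩ := hrest2
  have hE₁notin := (List.nodup_cons.1 hrestnd).1
  have ha₁o₁ : a₁ ≠ o₁ := fun h => hdisj o₁ ho₁p₀ a₁ (by simp [ha₁mid]) h.symm
  have ha₁E₂ : a₁ ≠ E₂ := fun h => hdisj2 a₁ ha₁mid E₂ (by simp) h
  have ha₂o₂ : a₂ ≠ o₂ := fun h => hdisj2 a₂ ha₂mid o₂ (by simp [ho₂s₀]) h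
  have ha₂E₁ : a₂ ≠ E₁ := fun h => hE₁notin (by rw [← h]; exact List.mem_append_left _ ha₂mid)
  have ho₁o₂ : o₁ ≠ o₂ := fun h => hdisj o₁ ho₁p₀ o₂ (by simp [ho₂s₀]) h
  have ho₁a₂ : o₁ ≠ a₂ := fun h => hdisj o₁ ho₁p₀ a₂ (by simp [ha₂mid]) h
  have ha₁o₂ : a₁ ≠ o₂ := fun h => hdisj2 a₁ ha₁mid o₂ (by simp [ho₂s₀]) h
  have ha₁a₂ : a₁ = a₂ → Ψ.sh a₁ = z := by
    intro h
    -- `mid` is duplicate-free with `head = last`, so `mid = [a₁]` and `g = a₁`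
    obtain ⟨x, xs, hx⟩ := List.exists_cons_of_ne_nil hmid
    have hxs : xs = [] := by
      by_contra hne
      have hl : mid.getLast hmid = xs.getLast hne := by simp only [hx, List.getLast_cons hne]
      have hh : mid.head hmid = x := by simp only [hx, List.head_cons]
      have : x ∈ xs := by
        have := List.getLast_mem hne
        rw [← hl, ← ha₂, ← h, ha₁, hh] at this; exact this
      rw [hx] at hmidnd
      exact (List.nodup_cons.1 hmidnd).1 this
    subst hxs
    have hg' : g = x := by rw [hx] at hgmid; simpa using hgmid
    have : a₁ = x := by rw [ha₁]; simp only [hx, List.head_cons]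
    rw [this, ← hg']; exact hgz
  -- the `src'`-side path `σ` and `w'`
  obtain ⟨w', σ, hσhead, hw'W, hσchain, hσsmall, hσγ, hσW, hσsrc', x, hwx, hxW, hxsmall, hxγ⟩ :=
    exists_sigma_exit hsurj hconn hΓ hω hX hzU hsrc hWsmall hW3
  have hσne : σ ≠ [] := by rintro rfl; simp at hσhead
  have hw'σ : w' ∈ σ := by
    have : σ.head hσne = w' := by rw [List.head?_eq_some_head hσne, Option.some.injEq] at hσhead; exact hσhead
    rw [← this]; exact List.head_mem _
  have hw'γ : Ψ.sh w' ∉ Ψ.γcols Γ ω := hσγ w' hw'σ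
  have hoff : ∀ {x : V}, x ∈ Ψ.γmin Γ ω → Ψ.sh w' ≠ Ψ.sh x := fun {x} hx h => hw'γ ⟨x, hx, h.symm⟩
  -- the certified terminal data and the routing
  have hT : Ψ.TerminalsX R z (Ψ.tRR R Γ z) (Ψ.tD Γ z) (Ψ.sR Γ z) (Ψ.sD Γ z) W E₁ E₂ w' :=
    { w'x := ⟨x, hwx, hxW, Ψ.inWinD_of_mem_small z hxsmall, fun h => hxγ ⟨g, hgγ, hgz.trans h.symm⟩, fun h => hxγ ⟨E₁, hE₁γ, h.symm⟩,
        fun h => hxγ ⟨E₂, hE₂γ, h.symm⟩⟩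
      ne := hE₁₂, E₁W := hE₁W, E₂W := hE₂W, E₁R := hE₁RP, E₂R := hE₂RP, E₁z := hE₁z, E₂z := hE₂z, w'W := hw'W,
      w'z := fun h => hw'γ ⟨g, hgγ, hgz.trans h.symm⟩, w'E₁ := hoff hE₁γ, w'E₂ := hoff hE₂γ,
      nbrs := ⟨o₁, a₁, a₂, o₂, hadj ho₁E, hadj hE₁a, hadj ha₂E, hadj hE₂o, ho₁W, ho₂W,
        inWin_of_mem_big hzbig (hγO.subset o₁ ho₁γ), inWin_of_mem_big hzbig (hγO.subset a₁ ha₁γ),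
        inWin_of_mem_big hzbig (hγO.subset a₂ ha₂γ), inWin_of_mem_big hzbig (hγO.subset o₂ ho₂γ),
        ha₁o₁, ha₁E₂, ha₂o₂, ha₂E₁, ho₁o₂, ho₁a₂, ha₁o₂, ha₁a₂, hoff ho₁γ, hoff ha₁γ, hoff ha₂γ, hoff ho₂γ⟩ }
  obtain ⟨r, hkey⟩ := hWlink E₁ E₂ w' hT
  have hRPbig : Ψ.RPblkR R Γ z ⊆ Ψ.big Γ := RPblkR_subset_big hΓ hm hzbig hzs
  have hPRP : ∀ x ∈ r.P, Ψ.sh x ∈ Ψ.RPblkR R Γ z := fun x hx => by have := (r.hP x hx).2; rwa [mem_lift] at this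
  refine ⟨⟨W, p₀, E₁, mid, E₂, s₀, r.P, r.c, r.Br, σ, hWwin, hγeq, hp₀, hs₀, hp₀W, hs₀W, hE₁W, hE₂W,
    fun x hx => (r.hP x hx).1, fun x hx => hRPbig (hPRP x hx), fun x hx => RPblkR_disjoint_zSeg hzbig hzZ hzb (hPRP x hx),
    r.hchain, r.hnodup, r.c_mem, r.hBr, r.hBrW, r.hBrchain, r.hBrnodup, r.hBrSP, r.hfwd_of_key hkey, ?_, by rw [r.hBrlast]; exact hσhead,
    hσchain, hσsmall, hσγ, hσW, hσsrc'⟩, hW3⟩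
  -- no structure vertex over `S_{3n}`
  intro v hv hvsrc _
  rw [mem_lift] at hvsrc
  rcases List.mem_append.1 hv with h | h
  · exact absurd hvsrc (DblkR_disjoint_src hΓ hm hzs (hWD v (r.hP v h).1))
  · exact absurd hvsrc (DblkR_disjoint_src hΓ hm hzs (hWD v (r.hBrW v (List.dropLast_subset _ h))))


/-! ## §2 Located surgeries, the Gluing Lemma and `θ(p_c) = 0` from `ShapedLinkageX R` -/

variable (Ψ)

/-- **THE ROUTING NODE FROM `ShapedLinkageX`** (DST 2016, §2.3, proof of Fact 2, "fix `R`"): under `ShapedLinkageX R` (`R ≥ 1`), inhabited columns and connected box lifts, located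
surgery outputs `SurgOutR Γ R` exist at all but at most `N₀(R) = 3(2R+1)² + (2R+3)² + 2(8R+1)²` points of `U(ω)`, for all data in range with `m ≥ 4R + 1` and every lattice
configuration `ω ∈ 𝒳` (the excluded points: `X₁R`, `X₂R`, `zBadR`, the square of radius `R` about the end of `γ_min`, and the points within `R` of the centre of `S'_n`).
[cite: DuminilCopinSidoraviciusTassion2016, §2.3 (proof of Fact 2, pp. 6–7)] -/
theorem sqLocatedSurgeriesR_of_shapedLinkageX {R : ℕ} (hL : Ψ.ShapedLinkageX R) (hR : 1 ≤ R) (hsurj : Function.Surjective Ψ.sh)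
    (hconn : ∀ (c : Site 2) (u : ℕ), 1 ≤ u → ∀ a ∈ Ψ.lift (sqBall c u), ∀ b ∈ Ψ.lift (sqBall c u), ∃ p : G.Walk a b, ∀ v ∈ p.support, v ∈ Ψ.lift (sqBall c u)) :
    ∃ r N₀ m₀ : ℕ, ∀ Γ : GlueData, m₀ ≤ Γ.m → Ψ.InRange Γ → ∀ ω : BondConfig V, ω ⊆ G.edgeSet → ω ∈ Ψ.evX Γ →
      ∃ Good : Finset (Site 2), (↑Good : Set (Site 2)) ⊆ Ψ.U Γ ω ∧ (Ψ.U Γ ω).ncard ≤ Good.card + N₀ ∧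
        ∀ z ∈ Good, ∃ ω' : BondConfig V, Ψ.SurgOutR Γ r ω z ω' := by
  refine ⟨R, (2 * R + 1) ^ 2 + (2 * (R + 1) + 1) ^ 2 + ((2 * (4 * R) + 1) ^ 2 + (2 * (4 * R) + 1) ^ 2) + (2 * R + 1) ^ 2 + (2 * R + 1) ^ 2, 4 * R + 1,
    fun Γ hm hΓ ω hω hX => ?_⟩
  have hA : ω ∈ Ψ.evA Γ := hX.1.1.1
  obtain ⟨hγO, -⟩ := Ψ.γmin_spec Γ hA
  set v₀ : V := (Ψ.γmin Γ ω).getLast hγO.ne_nil with hv₀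
  have hlast : (Ψ.γmin Γ ω).getLast? = some v₀ := List.getLast?_eq_some_getLast hγO.ne_nil
  set T : Finset (Site 2) := (Ψ.U_finite Γ ω).toFinset with hT
  have hTU : ∀ z, z ∈ T ↔ z ∈ Ψ.U Γ ω := fun z => Set.Finite.mem_toFinset _
  set good : Site 2 → Prop := fun z => z ∉ Ψ.X₁R R Γ ∧ z ∉ Ψ.X₂R R Γ ∧ z ∉ Ψ.zBadR R Γ ∧ (∀ v ∈ (Ψ.γmin Γ ω).getLast?, z ∉ sqBall (Ψ.sh v) R) ∧
    ¬ Ψ.src' Γ ⊆ sqBall z R with hgood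
  have hbs : ∀ z ∈ T, z ∈ Ψ.big Γ ∧ z ∈ Ψ.small Γ := by
    intro z hz
    obtain ⟨hzs, ⟨g, hg, hgz⟩, -⟩ := (hTU z).1 hz
    exact ⟨hgz ▸ hγO.subset g hg, hzs⟩
  refine ⟨T.filter good, fun z hz => (hTU z).1 (Finset.mem_filter.1 hz).1, ?_, ?_⟩
  · -- counting the excluded points
    rw [Set.ncard_eq_toFinset_card _ (Ψ.U_finite Γ ω), ← Finset.card_filter_add_card_filter_not good]
    change (T.filter good).card + (T.filter fun z => ¬good z).card ≤ (T.filter good).card + _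
    have hsub : (T.filter fun z => ¬good z) ⊆ T.filter (· ∈ Ψ.X₁R R Γ) ∪ T.filter (· ∈ Ψ.X₂R R Γ) ∪
        (T.filter (· ∈ sqBall (Ψ.centre + ![3 * (Γ.m : ℤ), Ψ.period * Γ.s - Γ.a]) (4 * R)) ∪
          T.filter (· ∈ sqBall (Ψ.centre + ![3 * (Γ.m : ℤ), Ψ.period * Γ.s + Γ.a]) (4 * R))) ∪ T.filter (· ∈ sqBall (Ψ.sh v₀) R) ∪
          T.filter (· ∈ sqBall (Ψ.glueCentre Γ.m Γ.s) R) := by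
      intro z hz
      rw [Finset.mem_filter] at hz
      obtain ⟨hzT, hng⟩ := hz
      simp only [hgood, not_and_or, not_not, not_forall, exists_prop] at hng
      simp only [Finset.mem_union, Finset.mem_filter]
      rcases hng with h | h | h | ⟨v, hv, h⟩ | h
      · exact Or.inl (Or.inl (Or.inl (Or.inl ⟨hzT, h⟩)))
      · exact Or.inl (Or.inl (Or.inl (Or.inr ⟨hzT, h⟩)))
      · rcases zBadR_subset h with h' | h'
        · exact Or.inl (Or.inl (Or.inr (Or.inl ⟨hzT, h'⟩)))
        · exact Or.inl (Or.inl (Or.inr (Or.inr ⟨hzT, h'⟩)))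
      · left; right
        rw [hlast] at hv
        simp only [Option.mem_def, Option.some.injEq] at hv
        subst hv
        exact ⟨hzT, h⟩
      · right
        refine ⟨hzT, ?_⟩
        -- `S'_n ⊆ sqBall z R` puts its centre within `R` of `z`
        have hc : Ψ.glueCentre Γ.m Γ.s ∈ Ψ.src' Γ := centre_mem_sqBall _ _
        exact mem_sqBall_comm.1 (h hc)
    have h1 : (T.filter (· ∈ Ψ.X₁R R Γ)).card ≤ (2 * R + 1) ^ 2 :=
      card_filter_le_of_forall_mem_sqBall T fun z hz hX => X₁R_subset hX (hbs z hz).1 (hbs z hz).2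
    have h2 : (T.filter (· ∈ Ψ.X₂R R Γ)).card ≤ (2 * (R + 1) + 1) ^ 2 :=
      card_filter_le_of_forall_mem_sqBall T fun z hz hX => X₂R_subset hX (hbs z hz).1
    have h3 : (T.filter (· ∈ sqBall (Ψ.centre + ![3 * (Γ.m : ℤ), Ψ.period * Γ.s - Γ.a]) (4 * R))).card ≤ (2 * (4 * R) + 1) ^ 2 :=
      card_filter_le_of_forall_mem_sqBall T fun z _ h => h
    have h4 : (T.filter (· ∈ sqBall (Ψ.centre + ![3 * (Γ.m : ℤ), Ψ.period * Γ.s + Γ.a]) (4 * R))).card ≤ (2 * (4 * R) + 1) ^ 2 :=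
      card_filter_le_of_forall_mem_sqBall T fun z _ h => h
    have h5 : (T.filter (· ∈ sqBall (Ψ.sh v₀) R)).card ≤ (2 * R + 1) ^ 2 := card_filter_le_of_forall_mem_sqBall T fun z _ h => h
    have h6 : (T.filter (· ∈ sqBall (Ψ.glueCentre Γ.m Γ.s) R)).card ≤ (2 * R + 1) ^ 2 := card_filter_le_of_forall_mem_sqBall T fun z _ h => h
    have := (Finset.card_le_card hsub).trans ((Finset.card_union_le _ _).trans (add_le_add ((Finset.card_union_le _ _).trans (add_le_add
      ((Finset.card_union_le _ _).trans (add_le_add ((Finset.card_union_le _ _).trans (add_le_add h1 h2)) ((Finset.card_union_le _ _).trans (add_le_add h3 h4))))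
      h5)) h6))
    omega
  · -- the surgery at a good point
    intro z hz
    obtain ⟨hzT, hg⟩ := Finset.mem_filter.1 hz
    obtain ⟨sg, hsg⟩ := exists_vsurgery_of_shapedLinkageX hL hR hsurj hconn hΓ hm hω hX ((hTU z).1 hzT) hg.1 hg.2.1 hg.2.2.1 hg.2.2.2.1 hg.2.2.2.2
    exact ⟨sg.newConfig, sg.surgOutR hX hsg⟩

/-- **THE SQUARE GLUING LEMMA FROM `ShapedLinkageX R`, `R ≥ 1`.** [cite: DuminilCopinSidoraviciusTassion2016, Lemma 6 and §2.3] -/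
theorem sqGluing_of_shapedLinkageX {R : ℕ} (hL : Ψ.ShapedLinkageX R) (hR : 1 ≤ R) (hsurj : Function.Surjective Ψ.sh)
    (hconn : ∀ (c : Site 2) (u : ℕ), 1 ≤ u → ∀ a ∈ Ψ.lift (sqBall c u), ∀ b ∈ Ψ.lift (sqBall c u), ∃ p : G.Walk a b, ∀ v ∈ p.support, v ∈ Ψ.lift (sqBall c u)) :
    Ψ.SqGluing :=
  Ψ.sqGluing_of_locatedSurgeriesR (Ψ.sqLocatedSurgeriesR_of_shapedLinkageX hL hR hsurj hconn)

/-- **`θ_v(p_c) = 0` FROM `ShapedLinkageX R`, `R ≥ 1`**: a connected graph with a square shadow with inhabited columns and connected box lifts, whose infinite cluster is a.s.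
unique at every density and whose shadow satisfies `ShapedLinkageX R`, dies at its own critical point at every vertex (DST's Theorem 1 transplanted to thin square-shadow
graphs; only the routing certificate is instance-specific).  Independent of p205010. [cite: DuminilCopinSidoraviciusTassion2016, Thm. 1, §2] [cite: BenjaminiSchramm1996, Conj. 4 / Question 3] -/
theorem theta_criticalProb_eq_zero_of_shapedLinkageX (hG : G.Connected) (hU : ∀ p : unitInterval, ∀ᵐ ω ∂(bondPercolation G p), numInfiniteClusters ω ≤ 1)
    (hsurj : Function.Surjective Ψ.sh)
    (hconn : ∀ (c : Site 2) (u : ℕ), 1 ≤ u → ∀ a ∈ Ψ.lift (sqBall c u), ∀ b ∈ Ψ.lift (sqBall c u), ∃ p : G.Walk a b, ∀ v ∈ p.support, v ∈ Ψ.lift (sqBall c u))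
    {R : ℕ} (hL : Ψ.ShapedLinkageX R) (hR : 1 ≤ R) (v : V) : theta G v (criticalProbIOf G v) = 0 :=
  Ψ.theta_criticalProb_eq_zero_of_sqGluing hG hU (Ψ.sqGluing_of_shapedLinkageX hL hR hsurj hconn) v

end SqShadow

end Summit.CriticalPhenomena.PercolationContinuityZ3.Theorems.Transplant

end
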